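import Literature.Barriers.Schanuel.EFunctionValuesAtAlgebraicPointsKrylov
import Literature.Barriers.Schanuel.EFunctionValuesAtAlgebraicPointsHeight
import Mathlib.Algebra.Polynomial.Div
import Mathlib.Algebra.Polynomial.RingDivision
import Mathlib.Algebra.Polynomial.Degree.Domain
import Mathlib.RingTheory.Coprime.Lemmas
import Mathlib.LinearAlgebra.Matrix.NonsingularInverse
import Mathlib.LinearAlgebra.Dimension.Constructions
import HarnessLib

/-!
# Barrier (Schanuel) `EFunctionValuesAtAlgebraicPoints`: Baker's Lemma 3 (non-vanishing of a derived determinant at `α`) — proofs only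

`Literature/Barriers/Schanuel/EFunctionValuesAtAlgebraicPointsLemma3.lean` — sibling file of
`EFunctionValuesAtAlgebraicPoints.lean` in the programme to discharge `siegelShidlovskii_algIndep`
(Siegel–Shidlovskii; Rivoal Thm. 5.10 = Baker Thm. 11.1). It proves the algebraic content of
Baker, *Transcendental Number Theory*, Ch. 11, Lemma 3 (p. 112; Rivoal Lemme 5.16): once
`Δ(x) ≢ 0` (Lemma 2), for `α` with `α f(α) ≠ 0` there are `n` distinct indices `J(j) < n + t`,
`t` the multiplicity of `α` as a zero of `Δ`, such that `det (P_{i,J(j)}(α)) ≠ 0`, and `t` is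
small because `Δ` has high order at `0` and bounded degree:

* `SiegelShidlovskii.eval_dualD_iterate_pow_smul` — `(dualD^t ((X−α)^t w))(α) = t! f(α)^t w(α)`;
* `SiegelShidlovskii.span_eval_kryVec_eq_top` — the vectors `q_j(α)`, `j < n + t`, span `Kⁿ`
  (Baker: "the linear forms `W_j` with `x = α`, `1 ≤ j ≤ n + t`, include `n` linearly
  independent forms"), via `D^t (∑ adj_{ja} q_j) = D^t (Δ e_a)` evaluated at `α`;
* `SiegelShidlovskii.exists_det_eval_kryVec_ne_zero` — hence an injection
  `Jsel : Fin n → Fin (n + t)` with `det (q_{Jsel j}(α)_i) ≠ 0` (Baker's `J(j)`);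
* `SiegelShidlovskii.rootMultiplicity_add_le` — `t + ord₀(∑PᵢEᵢ) ≤ n r + n² m + (n−1) + ord₀ E_{i₀}`
  for `α ≠ 0` (Baker: "`Δ` has a zero at `0` of order `≥ M − c₂` and degree `≤ nr + c₃`, so
  `t ≤ εr + c₄`").

All [folklore]; no named facts (Lemma 3 itself is assembled with the estimates later).

## References

* A. Baker, *Transcendental Number Theory*, CUP 1975, Ch. 11 §3, Lemma 3 (p. 112); Ch. 10
  Lemma 3 (p. 100) for the argument.
* [Rivoal2024] T. Rivoal, *Les E-fonctions et G-fonctions de Siegel* (2024), Lemme 5.16.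
-/

noncomputable section

open Polynomial Matrix
open scoped Nat

namespace Literature.Barriers.Schanuel

namespace SiegelShidlovskii

variable {K : Type*} [Field K] {n : ℕ}
variable (f : K[X]) (G : Matrix (Fin n) (Fin n) K[X])

/-! ### 1. Evaluation of coefficient vectors at a point -/

/-- Componentwise evaluation at `α`: `K[X]ⁿ → Kⁿ`, a `K`-linear map. [folklore] -/
def evalVec (α : K) : (Fin n → K[X]) →ₗ[K] (Fin n → K) where
  toFun q i := (q i).eval α
  map_add' q q' := by funext i; simp
  map_smul' c q := by funext i; simp

/-- Components of `evalVec`. [folklore] -/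
@[simp] theorem evalVec_apply (α : K) (q : Fin n → K[X]) (i : Fin n) :
    evalVec α q i = (q i).eval α := rfl

/-- `evalVec (g • q) = g(α) • evalVec q` for polynomial scalars. [folklore] -/
theorem evalVec_smul_poly (α : K) (g : K[X]) (q : Fin n → K[X]) :
    evalVec α (g • q) = g.eval α • evalVec α q := by
  funext i; simp [eval_mul]

/-- Evaluation maps `K[X]`-spans into `K`-spans of the evaluated vectors. [folklore] -/
theorem evalVec_mem_span (α : K) {S : Set (Fin n → K[X])} {q : Fin n → K[X]}
    (hq : q ∈ Submodule.span K[X] S) : evalVec α q ∈ Submodule.span K (evalVec α '' S) := by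
  induction hq using Submodule.span_induction with
  | mem x hx => exact Submodule.subset_span ⟨x, hx, rfl⟩
  | zero => simp
  | add x y _ _ hx hy => rw [map_add]; exact Submodule.add_mem _ hx hy
  | smul g x _ hx => rw [evalVec_smul_poly]; exact Submodule.smul_mem _ _ hx

/-! ### 2. `D^t((X − α)^t w)` evaluated at `α` -/

/-- **`(dualD^t ((X−α)^t • w))(α) = t! · f(α)^t · w(α)`** (the only term of the twisted Leibniz
expansion surviving at `α`). [folklore] -/
theorem eval_dualD_iterate_pow_smul (α : K) :
    ∀ (t : ℕ) (w : Fin n → K[X]), evalVec α ((dualD f G)^[t] ((X - C α) ^ t • w)) =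
      ((t ! : ℕ) : K) • (f.eval α) ^ t • evalVec α w := by
  intro t
  induction t with
  | zero => intro w; simp
  | succ t ih =>
    intro w
    -- `D((X-α)^{t+1} w) = (X-α)^t • ((t+1) f • w + (X - α) • D w)`
    have hstep : dualD f G ((X - C α) ^ (t + 1) • w) =
        (X - C α) ^ t • ((C ((t + 1 : ℕ) : K) * f) • w + (X - C α) • dualD f G w) := by
      rw [dualD_smul, derivative_X_sub_C_pow, Nat.add_sub_cancel, smul_add, ← mul_smul, ← mul_smul,
        pow_succ]
      congr 1
      ring_nf
    rw [Function.iterate_succ_apply, hstep, ih, map_add, evalVec_smul_poly, evalVec_smul_poly]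
    simp only [eval_mul, eval_C, eval_sub, eval_X, sub_self, zero_smul, add_zero, smul_smul,
      Nat.factorial_succ, Nat.cast_mul, pow_succ]
    congr 1
    ring

/-! ### 3. Krylov vectors under `D^t (g • ·)` -/

/-- `D^t (g • q_j)` lies in the `K[X]`-span of `q_j, …, q_{j+t}`. [folklore] -/
theorem dualD_iterate_smul_kryVec_mem_span (P : Fin n → K[X]) :
    ∀ (t : ℕ) (g : K[X]) (j : ℕ), (dualD f G)^[t] (g • kryVec f G P j) ∈
      Submodule.span K[X] {v | ∃ s, s ≤ j + t ∧ v = kryVec f G P s} := by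
  intro t
  induction t with
  | zero =>
    intro g j
    simp only [Function.iterate_zero, id_eq, add_zero]
    exact Submodule.smul_mem _ _ (Submodule.subset_span ⟨j, le_rfl, rfl⟩)
  | succ t ih =>
    intro g j
    rw [Function.iterate_succ_apply, dualD_smul, dualD_iterate_add]
    have hmono : ∀ {j' t' : ℕ}, j' + t' ≤ j + (t + 1) →
        Submodule.span K[X] {v : Fin n → K[X] | ∃ s, s ≤ j' + t' ∧ v = kryVec f G P s} ≤
          Submodule.span K[X] {v | ∃ s, s ≤ j + (t + 1) ∧ v = kryVec f G P s} := by
      intro j' t' h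
      apply Submodule.span_mono
      rintro v ⟨s, hs, rfl⟩
      exact ⟨s, hs.trans h, rfl⟩
    refine Submodule.add_mem _ (hmono (by omega) (ih _ j)) ?_
    have : dualD f G (kryVec f G P j) = kryVec f G P (j + 1) := by
      simp only [kryVec, Function.iterate_succ_apply']
    rw [this]
    exact hmono (by omega) (ih g (j + 1))

/-! ### 4. The vectors `q_j(α)`, `j < n + t`, span `Kⁿ` -/

/-- Cramer: `∑ⱼ adj(Δ-matrix)_{ja} • q_j = Δ • e_a`. [folklore] -/
theorem sum_adjugate_smul_kryVec (P : Fin n → K[X]) (a : Fin n) :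
    ∑ j : Fin n, (dMat f G P).adjugate j a • kryVec f G P j = Δ f G P • Pi.single a 1 := by
  classical
  funext i
  have h := congr_fun (congr_fun (Matrix.mul_adjugate (dMat f G P)) i) a
  simp only [Matrix.mul_apply, dMat_apply, Matrix.smul_apply, Matrix.one_apply, smul_eq_mul,
    mul_ite, mul_one, mul_zero] at h
  simp only [Finset.sum_apply, Pi.smul_apply, smul_eq_mul, Pi.single_apply, mul_ite, mul_one,
    mul_zero]
  rw [show Δ f G P = (dMat f G P).det from rfl, ← h]
  refine Finset.sum_congr rfl fun j _ => mul_comm _ _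

/-- **The evaluated Krylov vectors span `Kⁿ`** (Baker Ch. 11 Lemma 3 / Ch. 10 Lemma 3): with
`t` the multiplicity of `α` as a root of `Δ ≠ 0` and `f(α) ≠ 0`, the vectors `q_j(α)`,
`j < n + t`, span `Kⁿ`. [folklore] -/
theorem span_eval_kryVec_eq_top [CharZero K] (P : Fin n → K[X]) {α : K} (hf : f.eval α ≠ 0)
    (hΔ : Δ f G P ≠ 0) :
    Submodule.span K (Set.range fun j : Fin (n + (Δ f G P).rootMultiplicity α) =>
      evalVec α (kryVec f G P j)) = ⊤ := by
  classical
  set t := (Δ f G P).rootMultiplicity α with ht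
  obtain ⟨Δ₂, hΔ₂, hndvd⟩ := exists_eq_pow_rootMultiplicity_mul_and_not_dvd (Δ f G P) hΔ α
  have hΔ₂α : Δ₂.eval α ≠ 0 := fun h => hndvd (dvd_iff_isRoot.mpr h)
  rw [eq_top_iff]
  -- it suffices to catch every `e_a`
  suffices hea : ∀ a : Fin n, (Pi.single a (1 : K) : Fin n → K) ∈
      Submodule.span K (Set.range fun j : Fin (n + t) => evalVec α (kryVec f G P j)) by
    intro v _
    rw [show v = ∑ a, v a • (Pi.single a (1 : K) : Fin n → K) by
      funext i; simp [Finset.sum_apply, Pi.single_apply, Finset.sum_ite_eq]]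
    exact Submodule.sum_mem _ fun a _ => Submodule.smul_mem _ _ (hea a)
  intro a
  -- `D^t (Δ • e_a)` evaluated at `α` is a non-zero multiple of `e_a` …
  have hcoef : ((t ! : ℕ) : K) * (f.eval α) ^ t * Δ₂.eval α ≠ 0 :=
    mul_ne_zero (mul_ne_zero (by exact_mod_cast Nat.factorial_ne_zero t) (pow_ne_zero _ hf)) hΔ₂α
  have hev : evalVec α ((dualD f G)^[t] (Δ f G P • (Pi.single a 1 : Fin n → K[X]))) =
      (((t ! : ℕ) : K) * (f.eval α) ^ t * Δ₂.eval α) • (Pi.single a (1 : K) : Fin n → K) := by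
    rw [hΔ₂, mul_smul, eval_dualD_iterate_pow_smul, evalVec_smul_poly, smul_smul, smul_smul]
    congr 1
    funext i
    simp only [evalVec_apply, Pi.single_apply]
    split_ifs <;> simp
  -- … and lies in the span of the `q_j(α)`, `j < n + t`
  have hmem : evalVec α ((dualD f G)^[t] (Δ f G P • (Pi.single a 1 : Fin n → K[X]))) ∈
      Submodule.span K (Set.range fun j : Fin (n + t) => evalVec α (kryVec f G P j)) := by
    rw [← sum_adjugate_smul_kryVec, dualD_iterate_sum, map_sum]
    refine Submodule.sum_mem _ fun j _ => ?_
    have h1 := evalVec_mem_span α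
      (dualD_iterate_smul_kryVec_mem_span f G P t ((dMat f G P).adjugate j a) (j : ℕ))
    refine Submodule.span_mono ?_ h1
    rintro v ⟨w, ⟨s, hs, rfl⟩, rfl⟩
    exact ⟨⟨s, by omega⟩, rfl⟩
  rw [hev] at hmem
  have := Submodule.smul_mem _ (((t ! : ℕ) : K) * (f.eval α) ^ t * Δ₂.eval α)⁻¹ hmem
  rwa [smul_smul, inv_mul_cancel₀ hcoef, one_smul] at this

/-- **Baker's indices `J(j)`** (Ch. 11 Lemma 3): an injection `Jsel : Fin n → Fin (n + t)` with
`det (q_{Jsel j}(α)_i)_{ij} ≠ 0`. [folklore] -/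
theorem exists_det_eval_kryVec_ne_zero [CharZero K] (P : Fin n → K[X]) {α : K}
    (hf : f.eval α ≠ 0) (hΔ : Δ f G P ≠ 0) :
    ∃ Jsel : Fin n → Fin (n + (Δ f G P).rootMultiplicity α), Function.Injective Jsel ∧
      (Matrix.of fun i j => (kryVec f G P (Jsel j) i).eval α).det ≠ 0 := by
  classical
  set v : Fin (n + (Δ f G P).rootMultiplicity α) → (Fin n → K) :=
    fun j => evalVec α (kryVec f G P j) with hv
  obtain ⟨κ, a, ha, hspan, hli⟩ := exists_linearIndependent' (K := K) v
  haveI : Finite κ := Finite.of_injective a ha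
  haveI : Fintype κ := Fintype.ofFinite κ
  have hcard : Fintype.card κ = n := by
    rw [← finrank_span_eq_card hli, hspan, hv, span_eval_kryVec_eq_top f G P hf hΔ,
      finrank_top, Module.finrank_pi, Fintype.card_fin]
  set e : Fin n ≃ κ := (Fintype.equivFinOfCardEq hcard).symm with he
  refine ⟨a ∘ e, ha.comp e.injective, ?_⟩
  have hcols : LinearIndependent K (Matrix.of fun i j => (kryVec f G P (a (e j)) i).eval α).col := by
    have : (Matrix.of fun i j => (kryVec f G P (a (e j)) i).eval α).col = (v ∘ a) ∘ e := by
      funext j i; rfl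
    rw [this]
    exact hli.comp _ e.injective
  have hunit := Matrix.linearIndependent_cols_iff_isUnit.mp hcols
  rw [Matrix.isUnit_iff_isUnit_det, isUnit_iff_ne_zero] at hunit
  exact hunit

/-! ### 5. The multiplicity `t` is small -/

/-- The power-series order of a non-zero polynomial: `X^{ord} ∣ p` in `K[X]`. [folklore] -/
theorem X_pow_order_toNat_dvd {p : K[X]} :
    Polynomial.X ^ ((p : PowerSeries K)).order.toNat ∣ p := by
  rw [Polynomial.X_pow_dvd_iff]
  intro d hd
  have := PowerSeries.coeff_of_lt_order_toNat d hd
  rwa [Polynomial.coeff_coe] at this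

/-- `t + ord_X Δ ≤ deg Δ` for `α ≠ 0` (the two prime powers `(X-α)^t`, `X^{ord}` are coprime
divisors of `Δ`). [folklore] -/
theorem rootMultiplicity_add_order_le_natDegree {p : K[X]} (hp : p ≠ 0) {α : K} (hα : α ≠ 0) :
    p.rootMultiplicity α + ((p : PowerSeries K)).order.toNat ≤ p.natDegree := by
  have hcop : IsCoprime ((Polynomial.X - Polynomial.C α) ^ p.rootMultiplicity α)
      (Polynomial.X ^ ((p : PowerSeries K)).order.toNat) := by
    have h0 : IsCoprime (Polynomial.X - Polynomial.C α) (Polynomial.X - Polynomial.C (0 : K)) :=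
      isCoprime_X_sub_C_of_isUnit_sub (by rw [sub_zero]; exact isUnit_iff_ne_zero.mpr hα)
    rw [C_0, sub_zero] at h0
    exact h0.pow
  have hdvd := hcop.mul_dvd (pow_rootMultiplicity_dvd p α) X_pow_order_toNat_dvd
  have hdeg := natDegree_le_of_dvd hdvd hp
  rwa [natDegree_mul (pow_ne_zero _ (X_sub_C_ne_zero α)) (pow_ne_zero _ Polynomial.X_ne_zero),
    natDegree_pow, natDegree_X_sub_C, mul_one, natDegree_pow, natDegree_X, mul_one] at hdeg

/-- `↑Δ · E_{i₀} = ∑ⱼ L_j · ↑adj_{j i₀}` ("`Δ` remains unaltered if the `i₀`-th row is replaced by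
`E_{i₀}⁻¹ L_j`", Baker p. 112). [folklore] -/
theorem coe_Δ_mul_eq_sum (E : Fin n → PowerSeries K) (P : Fin n → K[X]) (i₀ : Fin n) :
    (Δ f G P : PowerSeries K) * E i₀ =
      ∑ j : Fin n, form (coeAlgHom K) E (kryVec f G P j) * ((dMat f G P).adjugate j i₀ : PowerSeries K) := by
  classical
  have h := congr_arg (form (coeAlgHom K) E) (sum_adjugate_smul_kryVec f G P i₀)
  rw [form_sum, form_smul, form_single, coeAlgHom_apply, coeAlgHom_apply, Polynomial.coe_one,
    one_mul] at h
  rw [← h]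
  refine Finset.sum_congr rfl fun j _ => ?_
  rw [form_smul, coeAlgHom_apply, mul_comm]

/-- **The multiplicity of `α` is small** (Baker Ch. 11 Lemma 3): if `∑ PᵢEᵢ` vanishes to order
`≥ v` at `0`, `α ≠ 0` and `E_{i₀} ≠ 0`, then
`t + v ≤ n r + n² m + (n − 1) + ord₀ E_{i₀}`, where `t` is the multiplicity of `α` as a root of
`Δ ≠ 0`. [folklore] -/
theorem rootMultiplicity_add_le (E : Fin n → PowerSeries K)
    (hE : IsSol (coeAlgHom K) (PowerSeries.derivative K) f G E) {i₀ : Fin n} (hi₀ : E i₀ ≠ 0)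
    (P : Fin n → K[X]) {r : ℕ} (hdeg : ∀ i, (P i).natDegree ≤ r) (hΔ : Δ f G P ≠ 0)
    {α : K} (hα : α ≠ 0) (v : ℕ) (hv : (v : ℕ∞) ≤ (form (coeAlgHom K) E P).order) :
    (Δ f G P).rootMultiplicity α + v ≤
      n * r + n * n * sysDeg f G + (n - 1) + ((E i₀).order).toNat := by
  -- order of the right-hand side of `Δ E_{i₀} = ∑ L_j adj`
  have hRHS : ((v - (n - 1) : ℕ) : ℕ∞) ≤ ((Δ f G P : PowerSeries K) * E i₀).order := by
    rw [coe_Δ_mul_eq_sum]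
    have hmem : ∀ j : Fin n, form (coeAlgHom K) E (kryVec f G P j) ∈ orderGE (K := K) (v - (n - 1)) := by
      intro j
      rcases le_or_gt (n - 1) v with hv' | hv'
      · apply le_order_form_dualD_iterate hE P (j : ℕ)
        refine le_trans ?_ hv
        have := j.isLt
        exact_mod_cast (by omega : v - (n - 1) + (j : ℕ) ≤ v)
      · have h0 : v - (n - 1) = 0 := by omega
        rw [mem_orderGE, h0]
        exact bot_le
    have : (∑ j : Fin n, form (coeAlgHom K) E (kryVec f G P j) *
        ((dMat f G P).adjugate j i₀ : PowerSeries K)) ∈ orderGE (K := K) (v - (n - 1)) :=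
      Submodule.sum_mem _ fun j _ =>
        le_trans (hmem j) (le_trans le_self_add (PowerSeries.le_order_mul _ _))
    exact this
  -- order of the left-hand side
  rw [PowerSeries.order_mul] at hRHS
  have hΔ0 : ((Δ f G P : PowerSeries K)) ≠ 0 := by
    rw [Ne, Polynomial.coe_eq_zero_iff]; exact hΔ
  have hordΔ : ((Δ f G P : PowerSeries K)).order ≠ ⊤ := by rwa [Ne, PowerSeries.order_eq_top]
  have hordE : (E i₀).order ≠ ⊤ := by rwa [Ne, PowerSeries.order_eq_top]
  have h1 : v - (n - 1) ≤ ((Δ f G P : PowerSeries K)).order.toNat + ((E i₀).order).toNat := by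
    have h := hRHS
    rw [← ENat.coe_toNat hordΔ, ← ENat.coe_toNat hordE] at h
    exact_mod_cast h
  have h2 := rootMultiplicity_add_order_le_natDegree hΔ hα
  have h3 := natDegree_Δ_le f G hdeg
  omega

end SiegelShidlovskii

end Literature.Barriers.Schanuel

end
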